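import Summits.BirchSwinnertonDyer.Rank1Residual.Supersingular.X6RankZeroWitness22678e1
import Summits.BirchSwinnertonDyer.BirchSwinnertonDyer.Theses.PrintX6
import HarnessLib

/-!
# Route `PrintX6` — T3 WITNESS VEHICLE: the Eisenstein half AT THE CELL `(22678e1, p = 5)` over the route's
# published inputs (cell `bsd-print-x6`, seat p1 gen 3, planner TURNKEY 2026-08-27T15:29:24Z / PLAN.md v3.1;
# `--supports` crux `EisensteinHalfFiveLe` (stmt-BirchSwinnertonDyer-20276) as helper: closes no item)

WHY THIS FILE. The tribunal fit of route `PrintX6` (D-0033) persists a WITNESS declaration for the attacked crux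
`EisensteinHalfFiveLe` — a kernel theorem exhibiting the crux's conclusion at ONE inhabited non-unit cell. Seat p4 landed
it ROUTE-INDEPENDENTLY (p542927, `Rank1Residual/Supersingular/X6RankZeroWitness22678e1.lean`, decl
`X6RankZero.eisensteinHalfFiveLe_cell_22678e1_at5`); that module's import closure (+1739 Summits modules: the
visibility records) forbids making it a route import (PLAN v3.1, measured). The born-mode tribunal kernel, however,
imports every built `Theorems/PrintX6*` module — so THIS thin module is the vehicle that puts the witness in the probe's
scope, and it states the witness in the ROUTE'S OWN CURRENCY: three of p4's named-fact binders (GZK `hGZK`, modularity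
`hmod`, the period comparison `hϖ`) are conjuncts 9, 8, 4 of the route's support item `PublishedInputsX6`
(stmt-BirchSwinnertonDyer-20302; glue `PublishedInputsX6OfParts` CLOSED p537101) and are projected out of it here.

WHAT IS PROVED. `eisensteinHalfFiveLe_cell_22678e1_at5_of_publishedInputsX6`: under `PublishedInputsX6` and p4's
remaining binders VERBATIM (Cassels–Tate `hCT`, Wuthrich 2014 Prop. 21 `hW` — PRINT tier, referee R-0.8/PA-3 —, Tate
uniformisation `hU`/`hU2`, Fisher 2016 Thm. 4.4 `hF44`, Fisher 2012 Thm. 13.2 `hF13`, the minimal models of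
`E = 22678e1` and of its rank-2 `5`-congruent partner `F = 430882i1`, the newform `f` of `E`, the engine's level-one
enclosure `hball0` of `3·L(E,1)/ω₁ = 1250`), for every rational `q` with `#Ш(E)_an = q` and `ord_5 q ≠ 0`:
`ord_5 q ≤ ord_5 #Ш(E/ℚ)` — the conclusion of `EisensteinHalfFiveLe` at the census cell of record `(22678e1, 5)`
(`ord_5 #Ш_an = 2 = ord_5 ∏c_ℓ`; N = 22678 = 2·17·23·29; an erratum-prime cell per the 15:27:15Z census). One line:
p4's theorem fed with `hPub`'s conjuncts. Per pair; NOT a class theorem; nothing booked (the cell is proved-by-name of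
record since referee A R318 via `bsdp_x6r0visblt_22678e1_5`'s ancestor). PARTITION: 0 cells; BEYOND-PRINT THEOREM: **NO**.

References: Cremona–Mazur 2000 §3 [CremonaMazur2000]; Fisher 2016 Thm. 4.4 [Fisher2016Visualizing7]; Fisher 2012
Thm. 13.2 [Fisher2012Hessian]; Wuthrich 2014 Prop. 21 [Wuthrich2014]; Cassels 1962 [Cassels1962ArithmeticIV];
Miller 2011 Def. 1.1 [Miller2011LMS]; HOME/PLAN.md v3.1; INBOX 2026-08-27T15:29:24Z.
-/

set_option autoImplicit false
set_option linter.dupNamespace false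

noncomputable section

open scoped Classical MatrixGroups ModularForm

open CongruenceSubgroup WeierstrassCurve Literature.NumberTheory.EllipticCurves
  Literature.NumberTheory.EllipticCurves.Rank1Residual
  Literature.NumberTheory.EllipticCurves.Rank1Residual.Typed
  Literature.NumberTheory.EllipticCurves.Rank1Residual.X11RankOneCertificates
  Literature.NumberTheory.EllipticCurves.Wuthrich2014
  Literature.NumberTheory.EllipticCurves.Fisher2016
  Literature.NumberTheory.EllipticCurves.Fisher2012
  Literature.NumberTheory.EllipticCurves.ModularForms
  Summit.BirchSwinnertonDyer.Rank1Residual.Supersingular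
  Summit.BirchSwinnertonDyer.BirchSwinnertonDyer.Theses.PrintX6

namespace Summit.BirchSwinnertonDyer.BirchSwinnertonDyer.Theorems.PrintX6

/-- **T3 witness of route `PrintX6` in the route's currency: the Eisenstein half of `BSD(E,5)` AT THE CELL
`(22678e1, 5)` over `PublishedInputsX6`.** Under the route's support item `PublishedInputsX6` (whose conjuncts 9, 8, 4
— GZK, modularity "entire L-function", the Néron/newform period comparison — replace p4's binders `hGZK`, `hmod`, `hϖ`)
and, VERBATIM from `X6RankZero.eisensteinHalfFiveLe_cell_22678e1_at5` (p542927), Cassels–Tate `hCT`, Wuthrich 2014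
Prop. 21 `hW`, Tate uniformisation `hU`/`hU2`, Fisher 2016 Thm. 4.4 `hF44`, Fisher 2012 Thm. 13.2 `hF13`, the minimal
models of `E = 22678e1` and `F = 430882i1`, the newform `f` of `E` and the level-one enclosure `hball0` of
`3·L(E,1)/ω₁ = 1250`: for every rational `q` with `#Ш(E)_an = q` and `ord_5 q ≠ 0`, `ord_5 q ≤ ord_5 #Ш(E/ℚ)` — the
conclusion of crux `EisensteinHalfFiveLe` at one inhabited non-unit cell (`ord_5 #Ш_an = 2`). Proof: p4's cell theorem
(visibility `bsdp_x6r0visblt_22678e1_5` ⇒ `BSD(E,5)` ⇒ `MissingLowerBoundAt` ⇒ the valuation inequality) with the three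
inputs projected out of `hPub`. Per pair; not a class theorem; closes nothing.
[cite: CremonaMazur2000, §3] [cite: Fisher2016Visualizing7, Thm. 4.4] [cite: Fisher2012Hessian, Thm. 13.2]
[cite: Wuthrich2014, Prop. 21 (p. 400)] [cite: Cassels1962ArithmeticIV] [cite: Miller2011LMS, Def. 1.1] -/
theorem eisensteinHalfFiveLe_cell_22678e1_at5_of_publishedInputsX6 (hPub : PublishedInputsX6)
    (hCT : exists_casselsTate_pairing (K := ℚ)) (hW : sha_dvd_analyticSha)
    (hU : Silverman1994_thmV53_tateUniformisation.{0})
    (hU2 : Silverman1994_thmV53_corV54_tateUniformisation.{0})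
    (hF44 : thm44_selmerLocalKer_iff_of_nonsplit_good) (hF13 : thm132_fiveCongruent_hessePencil)
    {W F : WeierstrassCurve ℚ} [W.IsElliptic] [W.IsGloballyMinimal] [F.IsElliptic] [F.IsGloballyMinimal]
    (hWeq : W = ⟨1, 0, 0, 3140254662, -139987982322460⟩) (hFeq : F = ⟨1, 0, 0, -14128, -645920⟩)
    {N : ℕ} [NeZero N] (f : CuspForm (Gamma0 N) 2) (hf : IsNewformOf W f)
    (hball0 : ∃ mid rad : ℝ, rad ≤ 1 / 10 ^ (20 : ℕ) ∧ |mid - ((1250 : ℤ) : ℝ)| ≤ 1 / 10 ^ (20 : ℕ) ∧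
      |((3 : ℕ) : ℝ) * (((1 : ℕ) : ℝ) * ((W.entireLFunction 1).re / plusPeriod f)) - mid| ≤ rad) :
    ∀ q : ℚ, shaAn W = (q : ℂ) → padicValRat 5 q ≠ 0 → padicValRat 5 q ≤ (padicValNat 5 W.shaOrder : ℤ) :=
  X6RankZero.eisensteinHalfFiveLe_cell_22678e1_at5 hCT hW hPub.2.2.2.2.2.2.2.2 hPub.2.2.2.2.2.2.2.1 hPub.2.2.2.1
    hU hU2 hF44 hF13 hWeq hFeq f hf hball0

end Summit.BirchSwinnertonDyer.BirchSwinnertonDyer.Theorems.PrintX6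

end
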